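import Summits.QuantumFields.BalabanUV.Beta.GAN24.FaceWordsDeepCurrents
import Summits.QuantumFields.BalabanUV.Beta.GAN24.FacePairingPairForm

/-!
# `BalabanUV.Beta.GAN24.ForcingFacePairFormGlue` — binder row G-an2-4 ∕ (CONV-C), W-slot (α-0), ROW (C)sym AT LEVELS `≥ 1` (rows T6-STEP of the OWNER's
# two-index tower, RULING R-gan24p1-g40-1): **THE GLUE — FROM THE THREE-WORD DISPLAY OF A FACE READ TO road-P2's `∃ T antisym²` SOCKET `hBF`** — Part 49 of
# `GAN24/FourFaceGaugeSectors` (G-an2-4 CRUX TEAM (2), leaf prover `b2b-balaban-gan24-formalise-leaf-02`, gen 69)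

NOT IN PRINT; OUR BOOKKEEPING ([folklore] finite index algebra BY NAME over Part 45 `FaceWordsDeepCurrents.faceWord_direct_eq ∕ faceWord_swap_eq`, Part 44
`FacePairingPairForm.eeWords_eq_pairForm` and road-P2 F9 `CombChargeAntisymPairForm.pairFormLS_of_pairForm`; 0 `def`, 0 cited fact, 0 `def … : Prop`, 0 sorry).
HONEST FRAMING (cell contract, verbatim): «discharging `BetaPertH` makes Bałaban's UV stability UNCONDITIONAL — a real constructive-QFT result; it is NOT the continuum
limit and NOT the Clay problem.»  HONEST DEPENDENCY (verbatim): «continuum YM on T⁴ ⇐ BetaPertH ∧ nine spine estimates (0/9 proved); BetaPertH ⇐ (D1) ∧ (D4) ∧ CAP+tail;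
G-an2-4 gates asym, D1 and NE2/3/4.»

WHAT.  Road-P2 g50's consumer `CombChargeTowerClosure` asks (`hBF`, WORD W-1 l.58070): `∃ T antisym², ∀ κ κ′ κ₁ κ₂, LS(F(κκ′;κ₁κ₂) + F(κ′κ;κ₁κ₂)) = T-form` for the face read
`F = FF_P(b̃_i)`.  Part 47 displays `F(μν;αβ) = c₀·Σ_{r′,u′ faces}(direct word + swapped word − W-word)`; THIS FILE is the index algebra that turns such a THREE-WORD DISPLAY
(hypothesis `hdisp`, the words in Part 45's literal with the exit-face indicator weights, `F` and the `W` face word `Ww` abstract functions of the four directions) into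
the socket: the two exchange words are `K²·(EE₁ + EE₂)` (Part 45, given Part 46's `hpush ∕ hD ∕ hDt`), `EE₁ + EE₂` is the entrywise pair form `P μ α ν β + P ν α μ β`
(Part 44, given leaf-04 F5's antisymmetries `hL ∕ hR`), the bond-symmetrised `W` face word has zero `LS` (hypothesis `hW0` — Part 48's letters after the assembler's
`W2SymOfK` split), and F9 closes: **`pairFormLS_of_threeWords`**.  What the assembler still supplies: `hdisp` (Part 47 + `ite_and_and_eq` + `tsum` linearity over the three
words) and `hW0` (Part 48 + the `W2SymOfK` unfolding) — both bookkeeping over typed letters; and leaf-04 F5 for `hL ∕ hR`.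
Asserts NO value of any table; discharges NOTHING of (C)_{≥1} ∕ `hstep` ∕ `hSrc` ∕ `hSrcX` by itself; NEVER «G-an2-4 closed» as (CONV-C); NOT D1, NOT `BetaPertH`, NOT continuum,
NOT Clay.  2026-08-24; no existing file touched.
-/

noncomputable section

open Finset
open scoped BigOperators
open Literature.MathematicalPhysics.QuantumFieldTheory
open Literature.MathematicalPhysics.QuantumFieldTheory.Balaban1983to89
open Literature.MathematicalPhysics.QuantumFieldTheory.Balaban1983to89.Beta
open ExpKernelCalculus (Site MKer Decays BiLoc shiftK comp)
open OneStepResolventKernel (Fib LocStencil)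
open AffineAveraging (box toSite)
open Summit.QuantumFields.BalabanUV.Beta.GAN24.CombChargeAntisymPairForm (pairFormLS_of_pairForm)
open Summit.QuantumFields.BalabanUV.Beta.GAN24.FaceWordsDeepCurrents (faceWord_direct_eq faceWord_swap_eq)
open Summit.QuantumFields.BalabanUV.Beta.GAN24.FacePairingPairForm (eeWords_eq_pairForm)

namespace Summit.QuantumFields.BalabanUV.Beta.GAN24.ForcingFacePairFormGlue

variable {d Lc P N : ℕ} [NeZero P] [NeZero N]
variable {X : MKer (d + 1) (Fib d)} {D S : Fin (d + 1) → Site (d + 1) → MKer (d + 1) (Fib d)} {CX CD Cs δ : ℝ}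

/-- NOT IN PRINT; OUR BOOKKEEPING.  **FROM THE THREE-WORD DISPLAY TO THE `∃ T antisym²` SOCKET.**  Data as in Part 45 (`X` decaying and `N`-block covariant; the coarse
bond family `D κ u` uniformly bi-localised at `Lc•u`, `(P, N)`-covariant; the fine local family `S`, `N`-covariant; the ENTRYWISE push law `hpush` with the exit-face
indicators `[u_κ % P = P−1]` ∕ `[t_κ % N = N−1]`) and in Part 44 (F5's two antisymmetries `hL`, `hR` of the period-`N` face currents of `S`); an abstract face read `F`
DISPLAYED (`hdisp`) as `c₀·(direct word + swapped word − Ww)` in Part 45's literal, and a `W` face word `Ww` with zero leg-and-bond symmetrised charge (`hW0`).  THEN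
`∃ R antisym², ∀ κ κ′ κ₁ κ₂, LS(F(κκ′;·) + F(κ′κ;·))(κ₁κ₂) = R κκ₁κ′κ₂ + R κ′κ₁κκ₂ + (R κκ₂κ′κ₁ + R κ′κ₂κκ₁)` — road-P2 g50's `hBF` shape (`R = 4·c₀·K²·P`). -/
theorem pairFormLS_of_threeWords (hLc : 1 ≤ Lc) (hX : Decays X CX δ) (hXt : ∀ s : Site (d + 1), shiftK (-((N : ℤ) • s)) X = X) (hδ : 0 < δ)
    (hD : ∀ κ u, BiLoc (D κ u) ((Lc : ℤ) • u) ((Lc : ℤ) • u) CD δ)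
    (hDt : ∀ (κ : Fin (d + 1)) (u s : Site (d + 1)), D κ (u + (P : ℤ) • s) = shiftK (-((N : ℤ) • s)) (D κ u))
    (hS : LocStencil S Cs δ) (hSt : ∀ (κ : Fin (d + 1)) (t s : Site (d + 1)), S κ (t + (N : ℤ) • s) = shiftK (-((N : ℤ) • s)) (S κ t)) (K : ℝ)
    (hpush : ∀ (κ : Fin (d + 1)) (x z : Site (d + 1)) (a b : Fib d),
      ∑' u : Site (d + 1), (if u κ % (P : ℤ) = (P : ℤ) - 1 then (1 : ℝ) else 0) * D κ u x z a b
        = K * ∑' t : Site (d + 1), (if t κ % (N : ℤ) = (N : ℤ) - 1 then (1 : ℝ) else 0) * S κ t x z a b)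
    (hL : ∀ (ν β : Fin (d + 1)) (p : Site (d + 1)) (a' : Fib d),
      (∑' q : Site (d + 1), (if q β % (N : ℤ) = (N : ℤ) - 1 then (1 : ℝ) else 0) *
          ∑' u : Site (d + 1), (if u ν % (N : ℤ) = (N : ℤ) - 1 then (1 : ℝ) else 0) * S ν u q p (Sum.inl β) a') +
        (∑' q : Site (d + 1), (if q ν % (N : ℤ) = (N : ℤ) - 1 then (1 : ℝ) else 0) *
          ∑' u : Site (d + 1), (if u β % (N : ℤ) = (N : ℤ) - 1 then (1 : ℝ) else 0) * S β u q p (Sum.inl ν) a') = 0)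
    (hR : ∀ (μ ν : Fin (d + 1)) (s : Site (d + 1)) (f : Fib d),
      (∑' s' : Site (d + 1), (if s' ν % (N : ℤ) = (N : ℤ) - 1 then (1 : ℝ) else 0) *
          ∑' t' : Site (d + 1), (if t' μ % (N : ℤ) = (N : ℤ) - 1 then (1 : ℝ) else 0) * S μ t' s s' f (Sum.inl ν)) +
        (∑' s' : Site (d + 1), (if s' μ % (N : ℤ) = (N : ℤ) - 1 then (1 : ℝ) else 0) *
          ∑' t' : Site (d + 1), (if t' ν % (N : ℤ) = (N : ℤ) - 1 then (1 : ℝ) else 0) * S ν t' s s' f (Sum.inl μ)) = 0)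
    (c₀ : ℝ) {F Ww : Fin (d + 1) → Fin (d + 1) → Fin (d + 1) → Fin (d + 1) → ℝ}
    (hdisp : ∀ μ ν α β : Fin (d + 1), F μ ν α β = c₀ *
      ((∑ r' ∈ box (d + 1) P, ∑' u' : Site (d + 1), (if toSite r' μ % (P : ℤ) = (P : ℤ) - 1 then (1 : ℝ) else 0) * (if u' ν % (P : ℤ) = (P : ℤ) - 1 then (1 : ℝ) else 0) *
          ∑' yw : Site (d + 1) × Site (d + 1), ((if yw.1 α % (N : ℤ) = (N : ℤ) - 1 then (1 : ℝ) else 0) * (if yw.2 β % (N : ℤ) = (N : ℤ) - 1 then (1 : ℝ) else 0)) *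
            comp (comp (D μ (toSite r')) X) (D ν u') yw.1 yw.2 (Sum.inl α) (Sum.inl β)) +
       (∑ r' ∈ box (d + 1) P, ∑' u' : Site (d + 1), (if toSite r' μ % (P : ℤ) = (P : ℤ) - 1 then (1 : ℝ) else 0) * (if u' ν % (P : ℤ) = (P : ℤ) - 1 then (1 : ℝ) else 0) *
          ∑' yw : Site (d + 1) × Site (d + 1), ((if yw.1 α % (N : ℤ) = (N : ℤ) - 1 then (1 : ℝ) else 0) * (if yw.2 β % (N : ℤ) = (N : ℤ) - 1 then (1 : ℝ) else 0)) *
            comp (comp (D ν u') X) (D μ (toSite r')) yw.1 yw.2 (Sum.inl α) (Sum.inl β)) -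
       Ww μ ν α β))
    (hW0 : ∀ κ κ' κ₁ κ₂ : Fin (d + 1), Ww κ κ' κ₁ κ₂ + Ww κ' κ κ₁ κ₂ + (Ww κ κ' κ₂ κ₁ + Ww κ' κ κ₂ κ₁) = 0) :
    ∃ R : Fin (d + 1) → Fin (d + 1) → Fin (d + 1) → Fin (d + 1) → ℝ,
      (∀ a b c e, R b a c e = -R a b c e) ∧ (∀ a b c e, R a b e c = -R a b c e) ∧
      ∀ κ κ' κ₁ κ₂ : Fin (d + 1),
        (F κ κ' κ₁ κ₂ + F κ' κ κ₁ κ₂) + (F κ' κ κ₁ κ₂ + F κ κ' κ₁ κ₂) + ((F κ κ' κ₂ κ₁ + F κ' κ κ₂ κ₁) + (F κ' κ κ₂ κ₁ + F κ κ' κ₂ κ₁))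
          = R κ κ₁ κ' κ₂ + R κ' κ₁ κ κ₂ + (R κ κ₂ κ' κ₁ + R κ' κ₂ κ κ₁) := by
  classical
  -- the indicator weights meet Part 45's hypotheses
  have hw : ∀ (κ : Fin (d + 1)) (u : Site (d + 1)), |(fun (κ : Fin (d + 1)) (u : Site (d + 1)) => if u κ % (P : ℤ) = (P : ℤ) - 1 then (1 : ℝ) else 0) κ u| ≤ 1 := by
    intro κ u; simp only; split_ifs <;> simp
  have hw' : ∀ (κ : Fin (d + 1)) (t : Site (d + 1)), |(fun (κ : Fin (d + 1)) (t : Site (d + 1)) => if t κ % (N : ℤ) = (N : ℤ) - 1 then (1 : ℝ) else 0) κ t| ≤ 1 := by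
    intro κ t; simp only; split_ifs <;> simp
  have hwP : ∀ (κ : Fin (d + 1)) (u s : Site (d + 1)), (fun (κ : Fin (d + 1)) (u : Site (d + 1)) => if u κ % (P : ℤ) = (P : ℤ) - 1 then (1 : ℝ) else 0) κ (u + (P : ℤ) • s)
      = (fun (κ : Fin (d + 1)) (u : Site (d + 1)) => if u κ % (P : ℤ) = (P : ℤ) - 1 then (1 : ℝ) else 0) κ u := by
    intro κ u s; simp only [PairingCellTransfer.face_coord_add_zsmul]
  have hw'N : ∀ (κ : Fin (d + 1)) (t s : Site (d + 1)), (fun (κ : Fin (d + 1)) (t : Site (d + 1)) => if t κ % (N : ℤ) = (N : ℤ) - 1 then (1 : ℝ) else 0) κ (t + (N : ℤ) • s)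
      = (fun (κ : Fin (d + 1)) (t : Site (d + 1)) => if t κ % (N : ℤ) = (N : ℤ) - 1 then (1 : ℝ) else 0) κ t := by
    intro κ t s; simp only [PairingCellTransfer.face_coord_add_zsmul]
  have hm : ∀ (α β : Fin (d + 1)) (yw : Site (d + 1) × Site (d + 1)),
      |(fun yw : Site (d + 1) × Site (d + 1) => (if yw.1 α % (N : ℤ) = (N : ℤ) - 1 then (1 : ℝ) else 0) * (if yw.2 β % (N : ℤ) = (N : ℤ) - 1 then (1 : ℝ) else 0)) yw| ≤ 1 := by
    intro α β yw; simp only; split_ifs <;> simp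
  have hmN : ∀ (α β : Fin (d + 1)) (y w₀ s : Site (d + 1)),
      (fun yw : Site (d + 1) × Site (d + 1) => (if yw.1 α % (N : ℤ) = (N : ℤ) - 1 then (1 : ℝ) else 0) * (if yw.2 β % (N : ℤ) = (N : ℤ) - 1 then (1 : ℝ) else 0))
          (y + (N : ℤ) • s, w₀ + (N : ℤ) • s)
        = (fun yw : Site (d + 1) × Site (d + 1) => (if yw.1 α % (N : ℤ) = (N : ℤ) - 1 then (1 : ℝ) else 0) * (if yw.2 β % (N : ℤ) = (N : ℤ) - 1 then (1 : ℝ) else 0)) (y, w₀) := by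
    intro α β y w₀ s; simp only [PairingCellTransfer.face_coord_add_zsmul]
  -- the two exchange words are `K²·EE₁` and `K²·EE₂`
  have hd := fun μ ν α β => faceWord_direct_eq (P := P) (N := N) hLc hX hXt hδ hD hDt hS hSt
    (fun κ u => if u κ % (P : ℤ) = (P : ℤ) - 1 then (1 : ℝ) else 0) (fun κ t => if t κ % (N : ℤ) = (N : ℤ) - 1 then (1 : ℝ) else 0)
    hw hw' hwP hw'N K hpush (fun yw : Site (d + 1) × Site (d + 1) => (if yw.1 α % (N : ℤ) = (N : ℤ) - 1 then (1 : ℝ) else 0) * (if yw.2 β % (N : ℤ) = (N : ℤ) - 1 then (1 : ℝ) else 0))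
    (hm α β) (hmN α β) μ ν (Sum.inl α) (Sum.inl β)
  have hs := fun μ ν α β => faceWord_swap_eq (P := P) (N := N) hLc hX hXt hδ hD hDt hS hSt
    (fun κ u => if u κ % (P : ℤ) = (P : ℤ) - 1 then (1 : ℝ) else 0) (fun κ t => if t κ % (N : ℤ) = (N : ℤ) - 1 then (1 : ℝ) else 0)
    hw hw' hwP hw'N K hpush (fun yw : Site (d + 1) × Site (d + 1) => (if yw.1 α % (N : ℤ) = (N : ℤ) - 1 then (1 : ℝ) else 0) * (if yw.2 β % (N : ℤ) = (N : ℤ) - 1 then (1 : ℝ) else 0))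
    (hm α β) (hmN α β) μ ν (Sum.inl α) (Sum.inl β)
  -- the pair form of `EE₁ + EE₂`
  obtain ⟨Pf, hP1, hP2, hE⟩ := eeWords_eq_pairForm (N := N) (G := X) hS hX hδ hSt hXt hL hR
  -- the EE part of the display as an entrywise pair form
  have hdisp' : ∀ μ ν α β : Fin (d + 1), F μ ν α β = c₀ * (K * K) * (Pf μ α ν β + Pf ν α μ β) - c₀ * Ww μ ν α β := by
    intro μ ν α β
    have e1 := hd μ ν α β
    have e2 := hs μ ν α β
    have e3 := hE μ ν α β
    beta_reduce at e1 e2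
    rw [hdisp μ ν α β, e1, e2, ← e3]
    ring
  refine ⟨fun a b c e => 4 * (c₀ * (K * K)) * Pf a b c e, ?_, ?_, fun κ κ' κ₁ κ₂ => ?_⟩
  · intro a b c e
    show 4 * (c₀ * (K * K)) * Pf b a c e = -(4 * (c₀ * (K * K)) * Pf a b c e)
    rw [hP1]; ring
  · intro a b c e
    show 4 * (c₀ * (K * K)) * Pf a b e c = -(4 * (c₀ * (K * K)) * Pf a b c e)
    rw [hP2]; ring
  · simp only [hdisp']
    linear_combination (-(2 * c₀)) * hW0 κ κ' κ₁ κ₂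

end Summit.QuantumFields.BalabanUV.Beta.GAN24.ForcingFacePairFormGlue

end
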